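/-
Copyright (c) 2026 the pub-hodgecm-mathlib formalisation cell (harness21).  Prover seat hodgecm-mathlib-K2E1-p12 (g3), Track B ∕ K2-LIT, h413 = `stmt-HodgeConjecture-24833`,
route of record `HCCMUnconditional`, ROADCARD «5Res ENDGAME BY FAMILIES» AMENDMENT #4 «S₀-SUPPORTED ATOMS», dealer K2E1-plan (g7) deal (284): THE INDEX-SPLIT GLUE — every ray-trivial
NON-self-dual `χ` is OFF-DUAL in the norm-twist sense of ★ (OD) Gram (`¬ (χ·(χʷ)⁻¹).IsNormTwist`), so the full family index of ★ C7 HEAD″ splits into the OD family (atom-free) and the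
self-dual family (finite by R1); plus the lattice adapter from the full-index exhaustion to ★ p861000's two-family `hEis`.
-/
import Summits.HodgeConjecture.HodgeConjecture.Theorems.K2E1ChiMaassSelbergCMTwo             -- ★ (K2-defs1∕p14): `reflectChar_posRealIdele` (χ ray-trivial ⇒ χʷ ray-trivial); brings ★ DEFS `reflectChar`
import Literature.NumberTheory.GaloisRepresentations.HeckeCharacterNormOneProofs             -- ★ `HeckeCharacter.isNormTwist_iff_forall_mem_normOneIdeles` (Tate §4.3)
import Literature.NumberTheory.Automorphic.IdeleClassGroupProofs                             -- ★ `exists_normOneIdeles_mul_posRealIdele` (`x = y·ρ(r)`, `‖y‖ = 1`)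
import Mathlib.Topology.Algebra.Module.Basic
import HarnessLib

/-!
# h413 ∕ Track B «K2-LIT», AMENDMENT #4 — helper `K2E1FamilyIndexSplitSelfDualU2`: (a) RAY-TRIVIAL + NOT SELF-DUAL ⇒ OFF-DUAL IN THE NORM-TWIST SENSE; (b) THE FULL-INDEX EXHAUSTION SPLITS
# INTO «¬ self-dual» ⊔ «self-dual»; (c) the self-dual sub-index as a `Finite` subtype (from R1's `Set.Finite`)

Cell `pub/hodgecm-mathlib`, crux h413 = `stmt-HodgeConjecture-24833`, route of record `HCCMUnconditional`; dealer K2E1-plan (g7) (284) (AMENDMENT #4 §1 «the cut»: OD blocks are atom-free by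
★ (OD) Gram ∕ ★ p860754; `S_sd` finite by R1).  THEOREMS ONLY (no `def`, no `instance`, no notation, no named-fact hypothesis, no `sorry`); lane `--supports stmt-HodgeConjecture-24833 --as
helper` (count-neutral).  Closes no socket.  (a) is generic over a quadratic datum `(F, E, c)`; (b) is pure lattice∕topology over any index type; (c) is a one-line adapter.

THE MATHEMATICS ([TateThesis1967, §4.3]; [MoeglinWaldspurger1995, II.2.1]).  (a) If `χ` is trivial on the positive real ray then so is `χʷ = (χ ∘ (c⊗1))⁻¹` (★ `reflectChar_posRealIdele`), hence so
is `ψ := χ·(χʷ)⁻¹`; if `ψ` were a norm twist it would be trivial on the norm-one ideles `𝕀_E¹` (Tate §4.3, ★ `isNormTwist_iff_forall_mem_normOneIdeles`), and since `𝕀_E = 𝕀_E¹·ρ(ℝ_{>0})`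
(★ `exists_normOneIdeles_mul_posRealIdele`) `ψ = 1`, i.e. `χʷ = χ` — so a NON-self-dual ray-trivial `χ` satisfies the hypothesis `¬ (χ·(χʷ)⁻¹).IsNormTwist` of ★ (OD) Gram
`chiPseudoEisenstein_inner_product_offDual_cm_two`, uniformly (this is what makes every non-sd member of `S_ω(K′)` an OD block, AMENDMENT #4 §1).  (b) `⨆_{b ∈ S} F b ≤ (⨆_{b ∈ S, ¬p b} F b) ⊔
(⨆_{b ∈ S, p b} F b)` termwise, then `closure` is monotone — turning ★ C7 HEAD″'s full-index `blocks_open` conclusion into ★ p861000's two-family `hEis`.  (c) `Set.Finite.to_subtype`.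
* §1 **`not_isNormTwist_mul_inv_reflectChar_of_rayTrivial_of_ne`** (+ `eq_reflectChar_of_isNormTwist_of_rayTrivial`, the contrapositive's content).
* §2 **`le_topologicalClosure_sup_iSup_split`** (generic lattice adapter), §3 `finite_subtype_sep_of_finite`.
FED-BY: (a)∕(c) carry no structural bundle (properties of a given `χ` ∕ a given finite set); (b) is unconditional lattice algebra (witness: any `S`, `p`, `F`, e.g. `S = ∅`).
HONEST LABEL: HC_CM is proved only modulo the 7 printed citations (2 remaining named inputs: hLiu418 = `stmt-HodgeConjecture-24832`, h413 = `stmt-HodgeConjecture-24833`) until rung 0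
closes; this file asserts no named fact and closes no socket.
References: [TateThesis1967] J. Tate, *Fourier analysis in number fields and Hecke's zeta-functions* (thesis 1950; in Cassels–Fröhlich 1967), §4.3; [MoeglinWaldspurger1995] C. Mœglin,
J.-L. Waldspurger, *Spectral Decomposition and Eisenstein Series*, II.2.1.
-/

set_option autoImplicit false
set_option linter.dupNamespace false  -- the mandated namespace repeats the summit's segment (`HodgeConjecture.HodgeConjecture`)

noncomputable section

open Set Filter Topology NumberField IsDedekindDomain
open Literature.NumberTheory.Automorphic Literature.NumberTheory.Automorphic.UnitaryGroup Literature.NumberTheory.GaloisRepresentations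
open Summit.HodgeConjecture.HodgeConjecture.Cruxes.H413.K2E1CharacterEisensteinU2Defs
open Summit.HodgeConjecture.HodgeConjecture.Cruxes.H413.K2E1ChiMaassSelbergCMTwo (reflectChar_posRealIdele)
open scoped NNReal

namespace Summit.HodgeConjecture.HodgeConjecture.Cruxes.H413.K2E1FamilyIndexSplitSelfDualU2

/-! ## §1 Ray-trivial and not self-dual ⇒ off-dual in the norm-twist sense -/

section RayTrivial

variable {F E : Type} [Field F] [Field E] [NumberField E] [Algebra F E] {c : E ≃ₐ[F] E}

/-- **A RAY-TRIVIAL `χ` WITH `χ·(χʷ)⁻¹` A NORM TWIST IS SELF-DUAL**: `χ`, `χʷ` trivial on the positive real ray ⇒ `ψ = χ·(χʷ)⁻¹` ray-trivial; norm twist ⇒ `ψ(𝕀_E¹) = 1` (Tate §4.3); `𝕀_E = 𝕀_E¹·ρ(ℝ_{>0})` ⇒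
`ψ = 1` ⇒ `χʷ = χ`. [cite: TateThesis1967, §4.3 (remark before §4.4)] -/
theorem eq_reflectChar_of_isNormTwist_of_rayTrivial {χ : HeckeCharacter E} (hray : ∀ r : ℝ≥0ˣ, χ (posRealIdele E r) = 1)
    (hnt : (χ * (reflectChar c χ)⁻¹).IsNormTwist) : reflectChar c χ = χ := by
  have hray' : ∀ r : ℝ≥0ˣ, reflectChar c χ (posRealIdele E r) = 1 := reflectChar_posRealIdele (c := c) hray
  have h1 : ∀ x ∈ normOneIdeles E, (χ * (reflectChar c χ)⁻¹) x = 1 := (HeckeCharacter.isNormTwist_iff_forall_mem_normOneIdeles _).1 hnt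
  have hψ : χ * (reflectChar c χ)⁻¹ = 1 := by
    refine HeckeCharacter.ext fun x => ?_
    obtain ⟨y, hy, r, rfl⟩ := exists_normOneIdeles_mul_posRealIdele E x
    rw [map_mul, h1 y hy, one_mul, HeckeCharacter.one_apply, HeckeCharacter.mul_apply, HeckeCharacter.inv_apply, hray r, hray' r, inv_one, mul_one]
  exact (mul_inv_eq_one.1 hψ).symm

/-- **RAY-TRIVIAL + NOT SELF-DUAL ⇒ OFF-DUAL IN THE NORM-TWIST SENSE** — the hypothesis `¬ (χ·(reflectChar c χ)⁻¹).IsNormTwist` of ★ (OD) Gram `chiPseudoEisenstein_inner_product_offDual_cm_two` for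
every non-self-dual member of the family index `S_ω(K′)` (AMENDMENT #4 §1: OD blocks are atom-free). [cite: TateThesis1967, §4.3] [cite: MoeglinWaldspurger1995, II.2.1] -/
theorem not_isNormTwist_mul_inv_reflectChar_of_rayTrivial_of_ne {χ : HeckeCharacter E} (hray : ∀ r : ℝ≥0ˣ, χ (posRealIdele E r) = 1)
    (hne : reflectChar c χ ≠ χ) : ¬ (χ * (reflectChar c χ)⁻¹).IsNormTwist :=
  fun hnt => hne (eq_reflectChar_of_isNormTwist_of_rayTrivial hray hnt)

end RayTrivial

/-! ## §2 The lattice adapter: full-index exhaustion ⇒ two-family exhaustion -/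

section Lattice

variable {ι : Type*} {M : Type*} [AddCommGroup M] [Module ℂ M]

/-- `⨆_{b : ↥S} F b ≤ (⨆_{b : ↥{x ∈ S | ¬ p x}} F b) ⊔ (⨆_{b : ↥{x ∈ S | p x}} F b)` (each term goes left or right). [folklore] -/
theorem iSup_subtype_le_sup_iSup_split (S : Set ι) (p : ι → Prop) (F : ι → Submodule ℂ M) :
    (⨆ b : ↥S, F (b : ι)) ≤ (⨆ b : ↥{x ∈ S | ¬ p x}, F (b : ι)) ⊔ (⨆ b : ↥{x ∈ S | p x}, F (b : ι)) := by
  refine iSup_le fun b => ?_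
  by_cases hb : p (b : ι)
  · exact (le_iSup (fun b' : ↥{x ∈ S | p x} => F (b' : ι)) ⟨(b : ι), b.2, hb⟩).trans le_sup_right
  · exact (le_iSup (fun b' : ↥{x ∈ S | ¬ p x} => F (b' : ι)) ⟨(b : ι), b.2, hb⟩).trans le_sup_left

/-- **THE INDEX-SPLIT ADAPTER**: `Eis ≤ closure ⨆_{b ∈ S} F b ⟹ Eis ≤ closure ((⨆_{b ∈ S, ¬p b} F b) ⊔ (⨆_{b ∈ S, p b} F b))` — ★ C7 HEAD″ `blocks_open`'s full-index conclusion in the two-family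
shape of ★ p861000's `hEis` (`p` = self-dual, `F b` = the closed block of `b`). [cite: MoeglinWaldspurger1995, II.2.4] -/
theorem le_topologicalClosure_sup_iSup_split [TopologicalSpace M] [ContinuousAdd M] [ContinuousConstSMul ℂ M] (S : Set ι) (p : ι → Prop) (F : ι → Submodule ℂ M) {Eis : Submodule ℂ M}
    (h : Eis ≤ (⨆ b : ↥S, F (b : ι)).topologicalClosure) :
    Eis ≤ ((⨆ b : ↥{x ∈ S | ¬ p x}, F (b : ι)) ⊔ (⨆ b : ↥{x ∈ S | p x}, F (b : ι))).topologicalClosure :=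
  h.trans (Submodule.topologicalClosure_mono (iSup_subtype_le_sup_iSup_split S p F))

/-- The converse comparison `(⨆_{¬p}) ⊔ (⨆_{p}) ≤ ⨆_{S}` (so the split loses nothing). [folklore] -/
theorem sup_iSup_split_le_iSup_subtype (S : Set ι) (p : ι → Prop) (F : ι → Submodule ℂ M) :
    (⨆ b : ↥{x ∈ S | ¬ p x}, F (b : ι)) ⊔ (⨆ b : ↥{x ∈ S | p x}, F (b : ι)) ≤ ⨆ b : ↥S, F (b : ι) :=
  sup_le (iSup_le fun b => le_iSup (fun b' : ↥S => F (b' : ι)) ⟨(b : ι), b.2.1⟩) (iSup_le fun b => le_iSup (fun b' : ↥S => F (b' : ι)) ⟨(b : ι), b.2.1⟩)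

end Lattice

/-! ## §3 The self-dual sub-index as a `Finite` subtype -/

/-- **`Finite ↥{x ∈ S | p x}`** from R1's `Set.Finite` head (K2E1-p13's `selfDual_families_finite`; hypothesis-first until ★). [folklore] -/
theorem finite_subtype_sep_of_finite {ι : Type*} {S : Set ι} {p : ι → Prop} (hfin : ({x ∈ S | p x} : Set ι).Finite) : Finite ↥{x ∈ S | p x} :=
  hfin.to_subtype

/-- The same from finiteness of the larger set `{x | p x}` (e.g. all self-dual ray-trivial `χ` with a section at level `K′_f`). [folklore] -/
theorem finite_subtype_sep_of_finite_setOf {ι : Type*} {S : Set ι} {p : ι → Prop} (hfin : ({x | p x} : Set ι).Finite) : Finite ↥{x ∈ S | p x} :=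
  (hfin.subset fun _ hx => hx.2).to_subtype

end Summit.HodgeConjecture.HodgeConjecture.Cruxes.H413.K2E1FamilyIndexSplitSelfDualU2

end
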